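import Summits.AnomalousDissipation.AnomalousDissipation.Theses.NeutralTaylorWaves
import Literature.Analysis.FunctionSpaces.TorusClassicalNSGluing
import Literature.Analysis.FunctionSpaces.TorusConvolution
import Summits.AnomalousDissipation.AnomalousDissipation.Theorems.WindLineWindyGalerkinSteadyZerothLawNormsOfH1Limit

/-!
# Stub `stub_calculusFacts` of the line `Sketch`
# (crux stmt-AnomalousDissipation-16315, `NeutralTaylorWaves.NewtonRealisation`)

Two elementary torus-calculus facts consumed by the composition `NewtonRealisation_of`:

* (i) for a smooth divergence-free `w` and a smooth `q`, the steady drifted Navier–Stokes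
  left-hand side `w·∇w − νΔw + ∇q − c∂₃w` is smooth and has ZERO MEAN on `T³` (each of
  `∫ (w·∇)w`, `∫ Δw`, `∫ ∇q`, `∫ ∂₃w` vanishes: transport identity for divergence-free `w` and
  `∫ ∂ᵢ(·) = 0` on the torus);
* (ii) Minkowski for the gradient seminorm, `√‖∇v‖₂² ≤ √‖∇u‖₂² + √‖∇(u − v)‖₂²` (the tuple
  `(∂ᵢ v)ᵢ` is an element of `L²(T³; ℓ²(Fin 3; ℝ³))`, `‖∇v‖₂² = Torus.gradNormSq v` is its squared
  `L²` norm, and `∂ᵢ` is linear on smooth fields — reused from the landed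
  `WindLineWindyGalerkinSteadyZerothLaw.partialDeriv_sub_apply`), together with the energy splitting
  `∫‖u‖² ≤ 2∫‖v‖² + 2∫‖u − v‖²` (pointwise `‖a‖² ≤ 2‖b‖² + 2‖a − b‖²`, integrated).
-/

set_option linter.dupNamespace false

noncomputable section

open Filter Set MeasureTheory Topology
open Literature.Analysis.FunctionSpaces Literature.Analysis.FunctionSpaces.Torus
open Summit.AnomalousDissipation.AnomalousDissipation.Theorems.WindLineWindyGalerkinSteadyZerothLaw
  (partialDeriv_sub_apply)

namespace Summit.AnomalousDissipation.AnomalousDissipation.Theorems.NewtonRealisation.CalculusFacts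

/-- The flat unit three-torus (local notation). -/
local notation "𝕋³" => UnitAddTorus (Fin 3)
/-- Velocity values (local notation). -/
local notation "E³" => EuclideanSpace ℝ (Fin 3)

/-! ## (i) The steady drifted left-hand side is smooth and mean-zero -/

/-- For smooth divergence-free `w` and smooth `q`, the field `w·∇w − νΔw + ∇q − c∂₃w` is smooth
and has zero mean on `T³` (`∫ (w·∇)w = 0` by the transport identity, `∫ Δw = ∫ ∇q = ∫ ∂₃w = 0`
since derivatives integrate to zero on the torus). -/
theorem isSmooth_and_hasZeroMean_steadyLHS (ν c : ℝ) {w : 𝕋³ → E³} {q : 𝕋³ → ℝ}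
    (hw : IsSmooth w) (hdiv : IsDivFree w) (hq : IsSmooth q) :
    IsSmooth (fun x => Torus.convect w w x - ν • Torus.laplacian w x + Torus.gradient q x -
        c • Torus.partialDeriv (2 : Fin 3) w x) ∧
      HasZeroMean (fun x => Torus.convect w w x - ν • Torus.laplacian w x + Torus.gradient q x -
        c • Torus.partialDeriv (2 : Fin 3) w x) := by
  have h1 : IsSmooth (Torus.convect w w) := hw.convect hw
  have h2 : IsSmooth (Torus.laplacian w) := hw.laplacian
  have h3 : IsSmooth (Torus.gradient q) := hq.gradient
  have h4 : IsSmooth (Torus.partialDeriv (2 : Fin 3) w) := hw.partialDeriv 2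
  refine ⟨?_, ?_⟩
  · have h : IsSmooth (Torus.convect w w - ν • Torus.laplacian w + Torus.gradient q -
        c • Torus.partialDeriv (2 : Fin 3) w) := ((h1.sub (h2.smul ν)).add h3).sub (h4.smul c)
    exact h
  · have i1 : Integrable (Torus.convect w w) volume := h1.integrable
    have i2 : Integrable (fun x => ν • Torus.laplacian w x) volume := h2.integrable.smul ν
    have i3 : Integrable (Torus.gradient q) volume := h3.integrable
    have i4 : Integrable (fun x => c • Torus.partialDeriv (2 : Fin 3) w x) volume :=
      h4.integrable.smul c
    have i12 : Integrable (fun x => Torus.convect w w x - ν • Torus.laplacian w x) volume :=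
      i1.sub i2
    have i123 : Integrable
        (fun x => Torus.convect w w x - ν • Torus.laplacian w x + Torus.gradient q x) volume :=
      i12.add i3
    unfold HasZeroMean
    rw [integral_sub i123 i4, integral_add i12 i3, integral_sub i1 i2, integral_smul,
      integral_smul, integral_convect_self_eq_zero hw hdiv, integral_laplacian_eq_zero_of_isSmooth hw,
      integral_gradient_eq_zero hq, integral_partialDeriv_eq_zero_holds hw (2 : Fin 3)]
    simp

/-! ## (ii) Minkowski for the gradient seminorm and the energy splitting -/

-- adapted from Summits/.../Theorems/WindLineWindyGalerkinSteadyZerothLawNormsOfH1Limit.lean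
-- (`integral_norm_sq_eq_norm_toLp_sq`)
/-- `∫ ‖f‖² = ‖f‖_{L²}²` for `f ∈ L²(T³; W)`, the `L²` norm being that of `MemLp.toLp f`. -/
theorem integral_norm_sq_eq_norm_toLp_sq {W : Type*} [NormedAddCommGroup W] {f : 𝕋³ → W}
    (hf : MemLp f 2 volume) : ∫ x, ‖f x‖ ^ 2 = ‖hf.toLp f‖ ^ 2 := by
  rw [Lp.norm_toLp, hf.eLpNorm_eq_integral_rpow_norm two_ne_zero ENNReal.ofNat_ne_top]
  simp only [ENNReal.toReal_ofNat, Real.rpow_two]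
  have h0 : 0 ≤ ∫ x, ‖f x‖ ^ 2 := integral_nonneg fun x => by positivity
  have e : (∫ x, ‖f x‖ ^ 2) ^ (2 : ℝ)⁻¹ = Real.sqrt (∫ x, ‖f x‖ ^ 2) := by
    rw [Real.sqrt_eq_rpow, one_div]
  rw [e, ENNReal.toReal_ofReal (Real.sqrt_nonneg _), Real.sq_sqrt h0]

/-- Minkowski in `L²(T³; W)` in the form `‖g‖₂ ≤ ‖f‖₂ + ‖f − g‖₂` (the triangle inequality of the
normed space `Lp W 2`). -/
theorem sqrt_integral_norm_sq_le_add {W : Type*} [NormedAddCommGroup W] {f g : 𝕋³ → W}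
    (hf : MemLp f 2 volume) (hg : MemLp g 2 volume) :
    Real.sqrt (∫ x, ‖g x‖ ^ 2) ≤
      Real.sqrt (∫ x, ‖f x‖ ^ 2) + Real.sqrt (∫ x, ‖f x - g x‖ ^ 2) := by
  have hfg : MemLp (fun x => f x - g x) 2 volume := hf.sub hg
  rw [integral_norm_sq_eq_norm_toLp_sq hf, integral_norm_sq_eq_norm_toLp_sq hg,
    integral_norm_sq_eq_norm_toLp_sq hfg, Real.sqrt_sq (norm_nonneg _),
    Real.sqrt_sq (norm_nonneg _), Real.sqrt_sq (norm_nonneg _)]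
  have e : hfg.toLp (fun x => f x - g x) = hf.toLp f - hg.toLp g := MemLp.toLp_sub hf hg
  rw [e]
  exact norm_le_norm_add_norm_sub _ _

/-- The gradient tuple `x ↦ (∂ᵢ v(x))ᵢ ∈ ℓ²(Fin 3; ℝ³)` of a smooth field is in `L²(T³)`
(it is continuous on the compact torus). -/
theorem memLp_two_gradTuple {v : 𝕋³ → E³} (hv : IsSmooth v) :
    MemLp (fun x => (WithLp.toLp 2 (fun i => partialDeriv i v x) : PiLp 2 (fun _ : Fin 3 => E³)))
      2 volume := by
  have hc : Continuous
      (fun x => (WithLp.toLp 2 (fun i => partialDeriv i v x) : PiLp 2 (fun _ : Fin 3 => E³))) :=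
    (PiLp.continuous_toLp 2 _).comp (continuous_pi fun i => (hv.partialDeriv i).continuous)
  exact hc.memLp_of_hasCompactSupport (HasCompactSupport.of_compactSpace _)

/-- `‖∇v‖₂² = ∫ ‖(∂ᵢ v)ᵢ‖²_{ℓ²}`: the squared gradient norm is the squared `L²` norm of the
gradient tuple. -/
theorem gradNormSq_eq_integral_norm_gradTuple_sq (v : 𝕋³ → E³) :
    gradNormSq v =
      ∫ x, ‖(WithLp.toLp 2 (fun i => partialDeriv i v x) : PiLp 2 (fun _ : Fin 3 => E³))‖ ^ 2 := by
  unfold gradNormSq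
  refine integral_congr_ae (ae_of_all _ fun x => ?_)
  simp only [PiLp.norm_sq_eq_of_L2]

/-- **Minkowski for the gradient seminorm**: `√‖∇v‖₂² ≤ √‖∇u‖₂² + √‖∇(u − v)‖₂²` for smooth
`u`, `v` on `T³`. -/
theorem sqrt_gradNormSq_le_add {u v : 𝕋³ → E³} (hu : IsSmooth u) (hv : IsSmooth v) :
    Real.sqrt (gradNormSq v) ≤
      Real.sqrt (gradNormSq u) + Real.sqrt (gradNormSq (fun x => u x - v x)) := by
  rw [gradNormSq_eq_integral_norm_gradTuple_sq v, gradNormSq_eq_integral_norm_gradTuple_sq u,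
    gradNormSq_eq_integral_norm_gradTuple_sq (fun x => u x - v x)]
  have hsub : ∀ x, (WithLp.toLp 2 (fun i => partialDeriv i (fun y => u y - v y) x) :
      PiLp 2 (fun _ : Fin 3 => E³)) =
        WithLp.toLp 2 (fun i => partialDeriv i u x) - WithLp.toLp 2 (fun i => partialDeriv i v x) := by
    intro x
    rw [← WithLp.toLp_sub]
    congr 1
    funext i
    rw [Pi.sub_apply, partialDeriv_sub_apply hu hv]
  simp_rw [hsub]
  exact sqrt_integral_norm_sq_le_add (memLp_two_gradTuple hu) (memLp_two_gradTuple hv)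

/-- **Energy splitting**: `∫‖u‖² ≤ 2∫‖v‖² + 2∫‖u − v‖²` for smooth fields on `T³`. -/
theorem integral_norm_sq_le_two_mul_add {u v : 𝕋³ → E³} (hu : IsSmooth u) (hv : IsSmooth v) :
    ∫ x, ‖u x‖ ^ 2 ≤ 2 * (∫ x, ‖v x‖ ^ 2) + 2 * ∫ x, ‖u x - v x‖ ^ 2 := by
  have hiu : Integrable (fun x => ‖u x‖ ^ 2) volume := hu.norm_sq.integrable
  have hiv : Integrable (fun x => ‖v x‖ ^ 2) volume := hv.norm_sq.integrable
  have hiw : Integrable (fun x => ‖u x - v x‖ ^ 2) volume := (hu.sub hv).norm_sq.integrable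
  have hpt : ∀ x, ‖u x‖ ^ 2 ≤ 2 * ‖v x‖ ^ 2 + 2 * ‖u x - v x‖ ^ 2 := fun x => by
    have h : ‖u x‖ ≤ ‖v x‖ + ‖u x - v x‖ := norm_le_norm_add_norm_sub' (u x) (v x)
    have h2 : ‖u x‖ ^ 2 ≤ (‖v x‖ + ‖u x - v x‖) ^ 2 := pow_le_pow_left₀ (norm_nonneg _) h 2
    nlinarith [h2, sq_nonneg (‖v x‖ - ‖u x - v x‖)]
  calc ∫ x, ‖u x‖ ^ 2 ≤ ∫ x, (2 * ‖v x‖ ^ 2 + 2 * ‖u x - v x‖ ^ 2) :=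
        integral_mono hiu ((hiv.const_mul 2).add (hiw.const_mul 2)) hpt
    _ = 2 * (∫ x, ‖v x‖ ^ 2) + 2 * ∫ x, ‖u x - v x‖ ^ 2 := by
        rw [integral_add (hiv.const_mul 2) (hiw.const_mul 2), integral_const_mul, integral_const_mul]

/-! ## The registered stub -/

/-- **Registered stub `stub_calculusFacts` (line `Sketch`).** (i) For smooth divergence-free `w`
and smooth `q` the full left-hand side `w·∇w − νΔw + ∇q − c∂₃w` is smooth and mean-zero;
(ii) Minkowski for the gradient seminorm `√‖∇v‖₂² ≤ √‖∇u‖₂² + √‖∇(u − v)‖₂²` and the energy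
splitting `∫‖u‖² ≤ 2∫‖v‖² + 2∫‖u − v‖²` for smooth fields on `T³`. -/
theorem stub_calculusFacts :
    (∀ (ν : ℝ) (w : 𝕋³ → E³) (q : 𝕋³ → ℝ) (c : ℝ), IsSmooth w → IsDivFree w → IsSmooth q →
      IsSmooth (fun x => Torus.convect w w x - ν • Torus.laplacian w x + Torus.gradient q x -
          c • Torus.partialDeriv (2 : Fin 3) w x) ∧
        HasZeroMean (fun x => Torus.convect w w x - ν • Torus.laplacian w x + Torus.gradient q x -
          c • Torus.partialDeriv (2 : Fin 3) w x)) ∧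
    (∀ (u v : 𝕋³ → E³), IsSmooth u → IsSmooth v →
      Real.sqrt (gradNormSq v) ≤ Real.sqrt (gradNormSq u) + Real.sqrt (gradNormSq (fun x => u x - v x)) ∧
      MeasureTheory.integral MeasureTheory.volume (fun x => ‖u x‖ ^ 2) ≤
        2 * MeasureTheory.integral MeasureTheory.volume (fun x => ‖v x‖ ^ 2) +
          2 * MeasureTheory.integral MeasureTheory.volume (fun x => ‖u x - v x‖ ^ 2)) :=
  ⟨fun ν _w _q c hw hdiv hq => isSmooth_and_hasZeroMean_steadyLHS ν c hw hdiv hq,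
    fun _u _v hu hv => ⟨sqrt_gradNormSq_le_add hu hv, integral_norm_sq_le_two_mul_add hu hv⟩⟩

end Summit.AnomalousDissipation.AnomalousDissipation.Theorems.NewtonRealisation.CalculusFacts

end
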